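import Literature.AnabelianGeometry.AbsoluteAnabelian.AutHolomorphicSpaces

/-!
# Proofs for [AbsTopIII] §2: Remark 2.3.3 (PROOF-ONLY companion of `AutHolomorphicSpaces`)

Discharge (kernel proof, no new definitions) of the named `Prop` fact `MorphismCompClosed`
([AbsTopIII] Rmk 2.3.3 p.54, as typed by the owner module
`Literature.AnabelianGeometry.AbsoluteAnabelian.AutHolomorphicSpaces`): "any composite of morphisms
of Aut-holomorphic spaces is again a morphism of Aut-holomorphic spaces".

In print this "follows immediately from Corollary 2.3, (i)"; AS TYPED (a morphism = a local
homeomorphism `φ` that transports `A_X(U)` onto `A_Y(V)` along every homeomorphism `U ≅ V` it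
induces between connected opens) it already holds on the generalised carrier by pure topology, which
is what we prove (`IsMorphism.comp`): if `ψ ∘ φ` restricts to a homeomorphism `e : U ≅ W`, then `φ|_U`
is injective, so — `φ` being an open map — `φ` induces a homeomorphism `e₁ : U ≅ φ(U)` onto the
connected open `φ(U) ⊆ Y`, `e = e₂ ∘ e₁` with `e₂ := e ∘ e₁⁻¹ : φ(U) ≅ W` induced by `ψ`, and
transport of structure along `e` is the composite of the two transports.

Bib key `MochizukiAbsTopIII2015`; locators = kurims manuscript pages (lit key `paper:url-5493eb38cbb7`).
HONEST FRAMING: OUR kernel check of an elementary clause of a refereed paper; no side taken on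
[IUTchIII] Cor 3.12.
-/

namespace Literature.AnabelianGeometry.AbsoluteAnabelian

open _root_.TopologicalSpace _root_.Topology

universe u

variable {X : Type u} [TopologicalSpace X] {Y : Type u} [TopologicalSpace Y]
  {Z : Type u} [TopologicalSpace Z]

/-- Transport of self-homeomorphisms (the bijection `Aut(U^top) ≅ Aut(V^top)` "induced" by a
homeomorphism `U ≅ V` in Def 2.1 (ii)) along a composite homeomorphism is the composite of the
transports.
[cite: MochizukiAbsTopIII2015, Definition 2.1 (ii) p.51] -/
theorem homeoConj_trans {U V W : Type u} [TopologicalSpace U] [TopologicalSpace V]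
    [TopologicalSpace W] (e₁ : U ≃ₜ V) (e₂ : V ≃ₜ W) :
    (homeoConj (e₁.trans e₂)).toMonoidHom =
      (homeoConj e₂).toMonoidHom.comp (homeoConj e₁).toMonoidHom := by
  ext ψ x
  rfl

/-- **Composites of morphisms of Aut-holomorphic spaces are morphisms** — on the generalised
carrier (arbitrary Aut-holomorphic structures `A`, `B`, `C`): if `φ : X → Y` and `ψ : Y → Z` are
morphisms (local homeomorphisms transporting `A(U)` onto `B(V)`, resp. `B(V)` onto `C(W)`, along
every induced homeomorphism of connected opens), then so is `ψ ∘ φ`.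
[cite: MochizukiAbsTopIII2015, Remark 2.3.3 p.54] -/
theorem IsMorphism.comp {A : AutHolStructure X} {B : AutHolStructure Y} {C : AutHolStructure Z}
    {φ : X → Y} {ψ : Y → Z} (hψ : IsMorphism B C ψ) (hφ : IsMorphism A B φ) :
    IsMorphism A C (ψ ∘ φ) := by
  have hφo : IsOpenMap φ := hφ.isLocalHomeomorph.isOpenMap
  have hφc : Continuous φ := hφ.isLocalHomeomorph.continuous
  refine ⟨hψ.isLocalHomeomorph.comp hφ.isLocalHomeomorph, ?_⟩
  intro U W _ _ e he
  -- the connected open `φ(U) ⊆ Y`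
  let V : ConnectedOpens Y :=
    ⟨⟨φ '' (U.1 : Set X), hφo _ U.1.isOpen⟩, U.2.image φ hφc.continuousOn⟩
  -- `φ|_U : U → φ(U)` is a continuous open bijection
  have hmaps : ∀ x, x ∈ (U.1 : Set X) → φ x ∈ (V.1 : Set Y) := fun x hx => ⟨x, hx, rfl⟩
  let f : U.1 → V.1 := Subtype.map φ hmaps
  have hf_inj : Function.Injective f := by
    intro x x' h
    apply e.injective
    apply Subtype.ext
    rw [he x, he x']
    exact congrArg (fun y : V.1 => ψ (y : Y)) h
  have hf_surj : Function.Surjective f := by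
    rintro ⟨y, x, hx, rfl⟩
    exact ⟨⟨x, hx⟩, rfl⟩
  have hf_cont : Continuous f := hφc.subtype_map hmaps
  have hf_open : IsOpenMap f := hφo.subtype_map U.1.isOpen hmaps
  let e₁ : U.1 ≃ₜ V.1 :=
    (Equiv.ofBijective f ⟨hf_inj, hf_surj⟩).toHomeomorphOfContinuousOpen hf_cont hf_open
  have he₁ : ∀ x : U.1, (e₁ x : Y) = φ x := fun x => rfl
  -- `e₂ := e ∘ e₁⁻¹ : φ(U) ≅ W` is induced by `ψ`
  let e₂ : V.1 ≃ₜ W.1 := e₁.symm.trans e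
  have he₂ : ∀ y : V.1, (e₂ y : Z) = ψ y := by
    intro y
    obtain ⟨x, rfl⟩ := e₁.surjective y
    show (e (e₁.symm (e₁ x)) : Z) = ψ (e₁ x)
    rw [e₁.symm_apply_apply, he x, he₁ x]
    rfl
  have hee : e = e₁.trans e₂ := by
    refine Homeomorph.ext fun x => ?_
    show e x = e (e₁.symm (e₁ x))
    rw [e₁.symm_apply_apply]
  -- transport along `e` = transport along `e₂` after transport along `e₁`
  rw [hee, homeoConj_trans, ← Subgroup.map_map,
    hφ.map_aut_eq U V U.2 V.2 e₁ he₁, hψ.map_aut_eq V W V.2 W.2 e₂ he₂]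

/-- **Rmk 2.3.3 holds as typed**: composites of morphisms of the Aut-holomorphic spaces
associated to Riemann surfaces are morphisms of Aut-holomorphic spaces (special case of
`IsMorphism.comp`).
[cite: MochizukiAbsTopIII2015, Remark 2.3.3 p.54] -/
theorem morphismCompClosed : MorphismCompClosed := by
  intro X Y Z _ _ _ _ _ _ _ _ _ _ _ _ φ ψ hφ hψ
  exact hψ.comp hφ

/-- Transport of self-homeomorphisms (Def 2.1 (ii)) along the identity homeomorphism is the
identity.
[cite: MochizukiAbsTopIII2015, Definition 2.1 (ii) p.51] -/
theorem homeoConj_refl {U : Type u} [TopologicalSpace U] :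
    (homeoConj (Homeomorph.refl U)).toMonoidHom = MonoidHom.id _ := by
  ext ψ x
  rfl

/-- The inverse of a homeomorphism that is a morphism of Aut-holomorphic spaces `(X, A) → (Y, B)`
is a morphism `(Y, B) → (X, A)` (so "isomorphism of Aut-holomorphic spaces" needs no separate
condition on the inverse, cf. the automorphisms `Aut(𝕌)` of Cor 2.4 (b)).
[cite: MochizukiAbsTopIII2015, Definition 2.1 (ii) p.51] -/
theorem IsMorphism.symm {A : AutHolStructure X} {B : AutHolStructure Y} {φ : X ≃ₜ Y}
    (hφ : IsMorphism A B φ) : IsMorphism B A φ.symm := by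
  refine ⟨φ.symm.isLocalHomeomorph, ?_⟩
  intro V U _ _ e he
  -- `e.symm : U ≅ V` is induced by `φ`
  have he' : ∀ x : U.1, (e.symm x : Y) = φ x := by
    intro x
    have h := he (e.symm x)
    rw [e.apply_symm_apply] at h
    rw [← φ.apply_symm_apply (e.symm x : Y), ← h]
  have key := hφ.map_aut_eq U V U.2 V.2 e.symm he'
  rw [← key, Subgroup.map_map, ← homeoConj_trans, Homeomorph.symm_trans_self, homeoConj_refl,
    Subgroup.map_id]

end Literature.AnabelianGeometry.AbsoluteAnabelian
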